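import Literature.NumberTheory.ConnesConsani2021.QuasiInnerArchDiscResidues
import Mathlib.Analysis.Complex.MeanValue
import Mathlib.Analysis.Complex.RemovableSingularity
import Mathlib.Analysis.Complex.LocallyUniformLimit
import Mathlib.Analysis.Normed.Module.Connected
import HarnessLib

/-!
# Connes–Consani 2021 (JNT) §2 — the Remark after Theorem 2.3: `(1 − 𝒫)ρ_∞𝒫` is injective with dense range (PROVED)

LINE 1 — LABEL: RH-FREE corpus literature (function theory of the archimedean local-factor ratio
`ρ_∞ ∘ ψ` on `S¹` and of the Hardy space `H²(𝕌)` in boundary form; no positivity statement, no statement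
about zeros of `ζ`); bears_on: W-C/W-P (P5 sequel vocabulary, no leaf role); WHAT THIS IS NOT: any claim
about RH — nothing in this file bears on the truth of RH.

Source: A. Connes, C. Consani, *Quasi-inner functions and local factors*, J. Number Theory **226** (2021)
139–167 = arXiv:2008.10974 [bib: `ConnesConsani2021QuasiInner`], §2, Remark after Theorem 2.3 (arXiv
Remark 1, tex chunk p0006:L72–L85 of the held text `paper:arxiv-2008.10974`): «The operator `(1 − 𝒫)ρ_∞𝒫`
is injective and has dense range.  This follows from Theorem 2.3: a vector `f` in the kernel … must vanish
on all the poles `x(n)` of `κ` and since `Σ(1 − |x(n)|) = ∞` this implies `f = 0` [Rudin, RCA, 15.23];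
similarly for the adjoint.»  Typed (seat t17, `QuasiInnerLocalFactors.lean :511`) as the named fact
`QuasiInner.remark_2_3`; DISCHARGED here: `QuasiInner.remark_2_3_holds` (cell rh-crit/cc, seat t1 g3).

## Road (the printed argument, routed through the LANDED Theorem 2.3)

Theorem 2.3 is a tree theorem (`QuasiInner.thm_2_3_holds`, seat t17 g2): `(1 − 𝒫)κ𝒫 = Σ_n c_n|ξ̂_n⟩⟨η̂_n|`
with `ξ_n, η_n` the Szegő-type vectors at the real points `x(n) = 1 − 4/(4n+3)` of the disc.  Hence
(§E, `hasSum_inner_hardyOffDiag_kappaArch`) `⟨z | (1 − 𝒫)κ𝒫 v⟩ = Σ_n e_n ⟨η_{x_n}|v⟩⟨z|ξ_{x_n}⟩` with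
nonvanishing real weights `e_n`, and the printed proof becomes two pieces of classical analysis, both
PROVED here from Mathlib:

* §A **moment uniqueness** (`eq_zero_of_forall_tsum_mul_pow_eq_zero`): for `c ∈ ℓ¹` and distinct nonzero
  reals `x_n → 1` in the disc, `Σ_n c_n x_n^k = 0` for all `k ≥ 0` forces `c = 0` — the generating function
  `Σ_n c_n/(1 − x_n w)` is holomorphic off the countable closed set `{x_n⁻¹} ∪ {1}` (whose complement is
  connected), vanishes on the unit disc, hence everywhere, and each simple pole isolates `c_m = 0`;
* §B **Blaschke uniqueness for `H²`** in power-series form (`eq_zero_of_tsum_mul_pow_eq_zero`, the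
  [Rudin 15.23] input, proved WITHOUT Jensen's formula): if `a ∈ ℓ²` and `Σ a_k x_n^k = 0` along a real
  sequence with `Σ(1 − |x_n|) = ∞` then `a = 0` — divide out the leading power and the first `N` zeros by
  a finite Blaschke product (iterated `dslope`), apply the mean value property to `h_N²` on `|y| = r`
  and Parseval on circles (`⨍_{|y|=r}|Σ b_k y^k|² ≤ Σ|b_k|²`), let `r → 1⁻`: `∏_{n<N} x_n^{−2} ≤ ‖a‖²/|a_m|²`
  for all `N`, contradicting `∏ x_n² → 0`.  Boundary-form corollaries for `f ∈ H²` (pairing with `η_x`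
  evaluates `Σ f̂(k) x^k`) and for `g ⊥ H²` (pairing with `ξ_x`) are §C.

Injectivity on `H²`: test `(1 − 𝒫)κ𝒫 f = 0` against the modes `e_{−k−1}` (`⟨e_{−k−1}|ξ_x⟩ = x^k`), §A gives
`⟨η_{x_n}|f⟩ = 0` for all `n`, §B/§C give `f = 0`.  Dense range in `(H²)^⊥`: a `g ⊥ H²` orthogonal to the
(closed) range is orthogonal to each `(1 − 𝒫)κ𝒫 e_k` (`⟨η_x|e_k⟩ = x^k`), §A gives `⟨ξ_{x_n}|g⟩ = 0`, §B/§C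
give `g = 0`.  Theorems only (no `def`, no new named fact); the analytic lemmas of §§A–B are stated for
general coefficient sequences and reusable (e.g. for the kernel description of Prop. 3.7 (ii)).

Nothing in this file bears on the truth of RH.
-/

noncomputable section

open _root_.MeasureTheory _root_.Complex AddCircle Filter Set Metric
open scoped Real ENNReal InnerProductSpace Topology ComplexConjugate

namespace Literature.NumberTheory.ConnesConsani2021

namespace QuasiInner


/-! ### B-a. Circle averages: norm bound and the Haar integral on `AddCircle 1` -/

/-- RH-FREE. `‖⨍ f‖ ≤ ⨍ ‖f‖` for circle averages. [folklore] -/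
private theorem norm_circleAverage_le_circleAverage_norm {E : Type*} [NormedAddCommGroup E]
    [NormedSpace ℝ E] (f : ℂ → E) (c : ℂ) (R : ℝ) :
    ‖Real.circleAverage f c R‖ ≤ Real.circleAverage (fun z => ‖f z‖) c R := by
  rw [Real.circleAverage_def, Real.circleAverage_def, norm_smul, smul_eq_mul,
    Real.norm_of_nonneg (by positivity)]
  exact mul_le_mul_of_nonneg_left
    (intervalIntegral.norm_integral_le_integral_norm (by positivity)) (by positivity)

/-- RH-FREE. The Haar integral over `S¹ = AddCircle 1` of `x ↦ φ(r·e^{2πix})` is the circle average of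
`φ` on the circle of radius `r`. [folklore] -/
private theorem integral_haarAddCircle_eq_circleAverage {E : Type*} [NormedAddCommGroup E]
    [NormedSpace ℝ E] (φ : ℂ → E) (r : ℝ) :
    ∫ x : AddCircle (1:ℝ), φ (r * (toCircle x : ℂ)) ∂haarAddCircle = Real.circleAverage φ 0 r := by
  rw [integral_haarAddCircle, inv_one, one_smul, ← AddCircle.integral_preimage 1 0, zero_add,
    ← intervalIntegral.integral_of_le zero_le_one, Real.circleAverage_def]
  have h : ∀ t : ℝ, φ (r * (toCircle ((t : ℝ) : AddCircle (1:ℝ)) : ℂ)) =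
      (fun θ : ℝ => φ (circleMap 0 r θ)) (2 * π * t) := by
    intro t
    simp only [circleMap_zero, AddCircle.toCircle_apply_mk, Circle.coe_exp, div_one]
  simp_rw [h]
  have h2 : (2 * π) • ∫ x in (0:ℝ)..1, (fun θ : ℝ => φ (circleMap 0 r θ)) (2 * π * x) =
      ∫ θ in 2 * π * 0..2 * π * 1, (fun θ : ℝ => φ (circleMap 0 r θ)) θ :=
    intervalIntegral.smul_integral_comp_mul_left (fun θ => φ (circleMap 0 r θ)) (2 * π)
  simp only [mul_zero, mul_one] at h2
  rw [← h2, inv_smul_smul₀ (by positivity : (2 * π : ℝ) ≠ 0)]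

/-! ### B-b. Power series with square-summable coefficients on the unit disc -/

/-- RH-FREE. A square-summable sequence is bounded by `max 1 (Σ‖a_k‖²)`. [folklore] -/
private theorem norm_le_max_one_tsum_sq {a : ℕ → ℂ} (ha : Summable fun k => ‖a k‖ ^ 2) (k : ℕ) :
    ‖a k‖ ≤ max 1 (∑' j, ‖a j‖ ^ 2) := by
  have h1 : ‖a k‖ ^ 2 ≤ ∑' j, ‖a j‖ ^ 2 :=
    ha.le_tsum k (fun j _ => by positivity)
  by_cases h : ‖a k‖ ≤ 1
  · exact h.trans (le_max_left _ _)
  · push Not at h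
    have : ‖a k‖ ≤ ‖a k‖ ^ 2 := by nlinarith [norm_nonneg (a k)]
    exact (this.trans h1).trans (le_max_right _ _)

/-- RH-FREE. `y ↦ Σ b_k y^k` with bounded coefficients is holomorphic on the unit disc. [folklore] -/
private theorem differentiableOn_tsum_mul_pow {b : ℕ → ℂ} {M : ℝ} (hM : ∀ k, ‖b k‖ ≤ M) :
    DifferentiableOn ℂ (fun y : ℂ => ∑' k, b k * y ^ k) (ball 0 1) := by
  intro y hy
  rw [mem_ball_zero_iff] at hy
  obtain ⟨ρ, hyρ, hρ1⟩ := exists_between hy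
  have hρ0 : 0 ≤ ρ := (norm_nonneg y).trans hyρ.le
  have hM0 : 0 ≤ M := (norm_nonneg _).trans (hM 0)
  have hdiff : DifferentiableOn ℂ (fun y : ℂ => ∑' k, b k * y ^ k) (ball 0 ρ) := by
    refine differentiableOn_tsum_of_summable_norm (u := fun k => M * ρ ^ k)
      ((summable_geometric_of_lt_one hρ0 hρ1).mul_left M) (fun k => ?_) isOpen_ball ?_
    · fun_prop
    · intro k w hw
      rw [mem_ball_zero_iff] at hw
      rw [norm_mul, norm_pow]
      exact mul_le_mul (hM k) (pow_le_pow_left₀ (norm_nonneg _) hw.le k) (by positivity) hM0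
  exact (hdiff.differentiableAt (isOpen_ball.mem_nhds (mem_ball_zero_iff.2 hyρ))).differentiableWithinAt

/-- RH-FREE. The terms `b_k y^k` are summable on the unit disc (bounded coefficients). [folklore] -/
private theorem summable_mul_pow_of_norm_lt_one {b : ℕ → ℂ} {M : ℝ} (hM : ∀ k, ‖b k‖ ≤ M) {y : ℂ}
    (hy : ‖y‖ < 1) : Summable fun k => b k * y ^ k := by
  have hM0 : 0 ≤ M := (norm_nonneg _).trans (hM 0)
  refine Summable.of_norm_bounded (g := fun k => M * ‖y‖ ^ k)
    ((summable_geometric_of_lt_one (norm_nonneg _) hy).mul_left M) fun k => ?_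
  rw [norm_mul, norm_pow]
  exact mul_le_mul_of_nonneg_right (hM k) (by positivity)

/-- RH-FREE. Parseval for an orthonormal sequence: `f = Σ a_k v_k ⇒ ‖f‖² = Σ |a_k|²`. [folklore] -/
private theorem hasSum_norm_sq_of_hasSum_smul_orthonormal {E : Type*} [NormedAddCommGroup E]
    [InnerProductSpace ℂ E] {v : ℕ → E} (hv : Orthonormal ℂ v) {a : ℕ → ℂ} {f : E}
    (hf : HasSum (fun k => a k • v k) f) : HasSum (fun k => ‖a k‖ ^ 2) (‖f‖ ^ 2) := by
  classical
  have hcoef : ∀ k, ⟪v k, f⟫_ℂ = a k := by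
    intro k
    have h1 := (innerSL ℂ (v k)).hasSum hf
    simp only [innerSL_apply_apply, inner_smul_right] at h1
    have h2 : (fun j => a j * ⟪v k, v j⟫_ℂ) = fun j => if j = k then a k else 0 := by
      funext j
      rw [orthonormal_iff_ite.1 hv k j]
      by_cases hjk : j = k
      · subst hjk; simp
      · simp [hjk, Ne.symm hjk]
    rw [h2] at h1
    exact h1.unique (hasSum_ite_eq k (a k))
  have h3 := (innerSL ℂ f).hasSum hf
  simp only [innerSL_apply_apply, inner_smul_right] at h3
  have h4 : (fun k => a k * ⟪f, v k⟫_ℂ) = fun k => ((‖a k‖ ^ 2 : ℝ) : ℂ) := by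
    funext k
    rw [← inner_conj_symm, hcoef, mul_conj, normSq_eq_norm_sq]
  rw [h4] at h3
  have h5 : ⟪f, f⟫_ℂ = ((‖f‖ ^ 2 : ℝ) : ℂ) := by
    rw [← inner_self_ofReal_re, inner_self_eq_norm_sq]
    rfl
  rw [h5] at h3
  exact Complex.hasSum_ofReal.1 h3

/-- RH-FREE. The non-negative modes `e_0, e_1, …` of `L²(S¹)` are orthonormal. [folklore] -/
private theorem orthonormal_fourierLp_natCast' (T : ℝ) [hT : Fact (0 < T)] :
    Orthonormal ℂ fun n : ℕ => fourierLp (T := T) 2 (n : ℤ) :=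
  (orthonormal_fourier (T := T)).comp _ Nat.cast_injective

/-- RH-FREE. The negative modes `e_{−1}, e_{−2}, …` of `L²(S¹)` are orthonormal. [folklore] -/
private theorem orthonormal_fourierLp_negSucc' (T : ℝ) [hT : Fact (0 < T)] :
    Orthonormal ℂ fun n : ℕ => fourierLp (T := T) 2 (-(n + 1 : ℤ)) :=
  (orthonormal_fourier (T := T)).comp (fun n : ℕ => -(n + 1 : ℤ)) fun a b h => by
    simpa using h

/-- RH-FREE. `‖toLp F‖²_{L²(S¹)} = ∫ ‖F‖²`. [folklore] -/
private theorem norm_toLp_sq_eq_integral (F : C(AddCircle (1:ℝ), ℂ)) :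
    ‖ContinuousMap.toLp (E := ℂ) 2 haarAddCircle ℂ F‖ ^ 2 =
      ∫ x : AddCircle (1:ℝ), ‖F x‖ ^ 2 ∂haarAddCircle := by
  set v := ContinuousMap.toLp (E := ℂ) 2 haarAddCircle ℂ F with hv
  have h1 : ((‖v‖ ^ 2 : ℝ) : ℂ) = ⟪v, v⟫_ℂ := by
    rw [inner_self_eq_norm_sq_to_K]; push_cast; rfl
  have h2 : ⟪v, v⟫_ℂ = ∫ x : AddCircle (1:ℝ), ⟪v x, v x⟫_ℂ ∂haarAddCircle := L2.inner_def v v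
  have h3 : (fun x : AddCircle (1:ℝ) => ⟪v x, v x⟫_ℂ) =ᵐ[haarAddCircle]
      fun x => ((‖F x‖ ^ 2 : ℝ) : ℂ) := by
    filter_upwards [ContinuousMap.coeFn_toLp (p := 2) (𝕜 := ℂ) haarAddCircle F] with x hx
    rw [hx, inner_self_eq_norm_sq_to_K]; push_cast; rfl
  rw [h2, integral_congr_ae h3, integral_complex_ofReal] at h1
  exact_mod_cast h1

/-- RH-FREE. **Parseval bound on circles**: for square-summable `b` and `0 ≤ r < 1`,
`⨍_{|y|=r} |Σ b_k y^k|² = Σ |b_k|² r^{2k} ≤ Σ |b_k|²`. [folklore] -/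
private theorem circleAverage_norm_sq_tsum_mul_pow_le {b : ℕ → ℂ} (hb : Summable fun k => ‖b k‖ ^ 2)
    {r : ℝ} (hr0 : 0 ≤ r) (hr1 : r < 1) :
    Real.circleAverage (fun y => ‖∑' k, b k * y ^ k‖ ^ 2) 0 r ≤ ∑' k, ‖b k‖ ^ 2 := by
  set M := max 1 (∑' j, ‖b j‖ ^ 2) with hM
  have hbM : ∀ k, ‖b k‖ ≤ M := norm_le_max_one_tsum_sq hb
  -- the function `x ↦ Σ b_k (r e^{2πix})^k` as a uniformly convergent Fourier series in `C(S¹)`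
  have hsumC : Summable fun k : ℕ => (b k * (r : ℂ) ^ k) • fourier (T := (1:ℝ)) (k : ℤ) := by
    refine Summable.of_norm_bounded (g := fun k : ℕ => M * r ^ k)
      ((summable_geometric_of_lt_one hr0 hr1).mul_left M) fun k => ?_
    rw [norm_smul, fourier_norm, mul_one, norm_mul, norm_pow, Complex.norm_real,
      Real.norm_of_nonneg hr0]
    exact mul_le_mul_of_nonneg_right (hbM k) (by positivity)
  set F : C(AddCircle (1:ℝ), ℂ) := ∑' k : ℕ, (b k * (r : ℂ) ^ k) • fourier (T := (1:ℝ)) (k : ℤ)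
    with hF
  have hFsum : HasSum (fun k : ℕ => (b k * (r : ℂ) ^ k) • fourier (T := (1:ℝ)) (k : ℤ)) F :=
    hsumC.hasSum
  have hFapply : ∀ x : AddCircle (1:ℝ), F x = ∑' k, b k * ((r : ℂ) * (toCircle x : ℂ)) ^ k := by
    intro x
    have h1 := (ContinuousMap.evalCLM ℂ x).hasSum hFsum
    simp only [ContinuousMap.evalCLM_apply, ContinuousMap.smul_apply, smul_eq_mul] at h1
    rw [← h1.tsum_eq]
    refine tsum_congr fun k => ?_
    have e : fourier (T := (1:ℝ)) (k : ℤ) x = ((toCircle x : Circle) : ℂ) ^ k := by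
      rw [fourier_apply, toCircle_zsmul]; simp
    rw [e, mul_pow]; ring
  -- in `L²(S¹)`: Parseval for the orthonormal modes `e_k`, `k ≥ 0`
  have hL2 : HasSum (fun k : ℕ => (b k * (r : ℂ) ^ k) • fourierLp (T := (1:ℝ)) 2 (k : ℤ))
      (ContinuousMap.toLp (E := ℂ) 2 haarAddCircle ℂ F) := by
    have h := (ContinuousMap.toLp (E := ℂ) 2 haarAddCircle ℂ).hasSum hFsum
    simp only [map_smul] at h
    exact h
  have hPars := hasSum_norm_sq_of_hasSum_smul_orthonormal (orthonormal_fourierLp_natCast' 1) hL2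
  have hnorm : ‖ContinuousMap.toLp (E := ℂ) 2 haarAddCircle ℂ F‖ ^ 2 ≤ ∑' k, ‖b k‖ ^ 2 := by
    rw [← hPars.tsum_eq]
    refine hPars.summable.tsum_le_tsum (fun k => ?_) hb
    rw [norm_mul, norm_pow, Complex.norm_real, Real.norm_of_nonneg hr0, mul_pow]
    exact mul_le_of_le_one_right (by positivity) (pow_le_one₀ (by positivity) (pow_le_one₀ hr0 hr1.le))
  -- `‖toLp F‖² = ∫ |F|² = ⨍_{|y|=r} |Σ b_k y^k|²`
  rw [norm_toLp_sq_eq_integral] at hnorm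
  have hint : ∫ x : AddCircle (1:ℝ), ‖F x‖ ^ 2 ∂haarAddCircle =
      Real.circleAverage (fun y => ‖∑' k, b k * y ^ k‖ ^ 2) 0 r := by
    rw [← integral_haarAddCircle_eq_circleAverage (fun y => ‖∑' k, b k * y ^ k‖ ^ 2) r]
    refine integral_congr_ae (ae_of_all _ fun x => ?_)
    simp only [hFapply]
  rwa [hint] at hnorm

/-! ### B-c. Dividing out finitely many real zeros; the finite Blaschke quotient -/

/-- RH-FREE. A holomorphic `G` on the disc vanishing at distinct points `x_0,…,x_{N−1}` is
`q · ∏(y − x_n)` with `q` holomorphic (iterated `dslope`). [folklore] -/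
private theorem exists_differentiableOn_mul_prod_sub_eq {G : ℂ → ℂ} (hG : DifferentiableOn ℂ G (ball 0 1))
    {x : ℕ → ℝ} (hx1 : ∀ n, |x n| < 1) (hinj : Function.Injective x) (hGx : ∀ n, G (x n) = 0)
    (N : ℕ) :
    ∃ q : ℂ → ℂ, DifferentiableOn ℂ q (ball 0 1) ∧
      ∀ y ∈ ball (0:ℂ) 1, q y * ∏ n ∈ Finset.range N, (y - x n) = G y := by
  induction N with
  | zero => exact ⟨G, hG, fun y _ => by simp⟩
  | succ N ih =>
    obtain ⟨q, hq, hqG⟩ := ih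
    have hxN : ((x N : ℝ) : ℂ) ∈ ball (0:ℂ) 1 := by
      rw [mem_ball_zero_iff, Complex.norm_real, Real.norm_eq_abs]; exact hx1 N
    have hqN : q (x N) = 0 := by
      have h := hqG _ hxN
      rw [hGx N] at h
      have hprod : ∏ n ∈ Finset.range N, ((x N : ℂ) - x n) ≠ 0 := by
        rw [Finset.prod_ne_zero_iff]
        intro n hn
        rw [Finset.mem_range] at hn
        rw [sub_ne_zero, Ne, Complex.ofReal_inj]
        exact fun h' => (Nat.lt_irrefl n) (by rwa [hinj h'] at hn)
      exact (mul_eq_zero.1 h).resolve_right hprod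
    refine ⟨dslope q (x N), (Complex.differentiableOn_dslope (isOpen_ball.mem_nhds hxN)).2 hq,
      fun y hy => ?_⟩
    by_cases hyx : y = x N
    · subst hyx
      rw [Finset.prod_range_succ, sub_self, mul_zero, mul_zero, hGx]
    · rw [dslope_of_ne _ hyx, slope, hqN, vsub_eq_sub, sub_zero, Finset.prod_range_succ, smul_eq_mul,
        ← hqG y hy]
      field_simp [sub_ne_zero.2 hyx]

/-- RH-FREE. The finite-Blaschke-factor estimate on the circle `|y| = r`, `|x| < r < 1` (`x` real):
`|1 − xy|² = |y − x|² + (1 − x²)(1 − r²) ≤ (1 + (1 − x²)(1 − r²)/(r − |x|)²)·|y − x|²`. [folklore] -/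
private theorem norm_one_sub_mul_sq_le {x r : ℝ} {y : ℂ} (hxr : |x| < r) (hr1 : r < 1) (hy : ‖y‖ = r) :
    ‖1 - (x : ℂ) * y‖ ^ 2 ≤ (1 + (1 - x ^ 2) * (1 - r ^ 2) / (r - |x|) ^ 2) * ‖y - x‖ ^ 2 := by
  have hid : ‖1 - (x : ℂ) * y‖ ^ 2 = ‖y - x‖ ^ 2 + (1 - x ^ 2) * (1 - r ^ 2) := by
    have h3 : y.re ^ 2 + y.im ^ 2 = r ^ 2 := by
      rw [← hy, Complex.sq_norm, Complex.normSq_apply]; ring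
    rw [Complex.sq_norm, Complex.sq_norm, Complex.normSq_apply, Complex.normSq_apply]
    simp only [sub_re, one_re, mul_re, ofReal_re, ofReal_im, zero_mul, sub_zero, sub_im, one_im,
      mul_im, add_zero, zero_sub]
    nlinarith [h3]
  have hd : r - |x| ≤ ‖y - x‖ := by
    have := norm_sub_norm_le y (x : ℂ)
    rw [hy, Complex.norm_real, Real.norm_eq_abs] at this
    linarith
  have hd0 : 0 < r - |x| := by linarith
  have hpos : 0 ≤ (1 - x ^ 2) * (1 - r ^ 2) := by
    have : x ^ 2 < 1 := by
      rw [← sq_abs]; nlinarith [abs_nonneg x]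
    have : r ^ 2 < 1 := by nlinarith [hd0, abs_nonneg x]
    nlinarith
  rw [hid, add_mul, one_mul, add_le_add_iff_left, div_mul_eq_mul_div, le_div_iff₀ (by positivity)]
  exact mul_le_mul_of_nonneg_left (pow_le_pow_left₀ hd0.le hd 2) hpos

/-- RH-FREE. The Blaschke majorant `∏ (1 + (1 − x_n²)(1 − r²)/(r − |x_n|)²) → 1` as `r → 1⁻`. [folklore] -/
private theorem tendsto_prod_blaschkeMajorant {x : ℕ → ℝ} (hx1 : ∀ n, |x n| < 1) (N : ℕ) :
    Tendsto (fun r : ℝ => ∏ n ∈ Finset.range N, (1 + (1 - x n ^ 2) * (1 - r ^ 2) / (r - |x n|) ^ 2))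
      (𝓝[<] 1) (𝓝 1) := by
  have key : ∀ n, Tendsto (fun r : ℝ => 1 + (1 - x n ^ 2) * (1 - r ^ 2) / (r - |x n|) ^ 2)
      (𝓝 1) (𝓝 1) := by
    intro n
    have hne : ((1:ℝ) - |x n|) ^ 2 ≠ 0 := by have := hx1 n; positivity
    have hcont : ContinuousAt (fun r : ℝ => 1 + (1 - x n ^ 2) * (1 - r ^ 2) / (r - |x n|) ^ 2) 1 := by
      refine continuousAt_const.add ((continuousAt_const.mul ?_).div ?_ (by simpa using hne))
      · exact continuousAt_const.sub (continuousAt_id.pow 2)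
      · exact (continuousAt_id.sub continuousAt_const).pow 2
    simpa using hcont.tendsto
  have h := tendsto_finsetProd (Finset.range N) fun n _ => key n
  simp only [Finset.prod_const_one] at h
  exact h.mono_left nhdsWithin_le_nhds

/-- RH-FREE. `∏_{n<N} x_n² → 0` when `Σ (1 − |x_n|) = ∞` (the non-Blaschke condition). [folklore] -/
private theorem tendsto_prod_sq_of_not_summable {x : ℕ → ℝ} (hx1 : ∀ n, |x n| < 1)
    (hdiv : ¬ Summable fun n => 1 - |x n|) :
    Tendsto (fun N => ∏ n ∈ Finset.range N, x n ^ 2) atTop (𝓝 0) := by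
  have hs : Tendsto (fun N => ∑ n ∈ Finset.range N, (1 - |x n|)) atTop atTop :=
    (not_summable_iff_tendsto_nat_atTop_of_nonneg (fun n => by linarith [hx1 n])).1 hdiv
  have hexp : Tendsto (fun N => Real.exp (-(∑ n ∈ Finset.range N, (1 - |x n|)))) atTop (𝓝 0) :=
    Real.tendsto_exp_atBot.comp (tendsto_neg_atTop_atBot.comp hs)
  refine squeeze_zero (fun N => Finset.prod_nonneg fun n _ => sq_nonneg _) (fun N => ?_) hexp
  rw [← Finset.sum_neg_distrib, Real.exp_sum]
  refine Finset.prod_le_prod (fun n _ => sq_nonneg _) fun n _ => ?_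
  have h1 : x n ^ 2 ≤ |x n| := by
    rw [← sq_abs]; nlinarith [abs_nonneg (x n), hx1 n]
  have h2 : |x n| ≤ Real.exp (-(1 - |x n|)) := by
    have := Real.add_one_le_exp (-(1 - |x n|)); linarith
  exact h1.trans h2

/-! ### B-d. Blaschke uniqueness for `H²` in power-series form -/

/-- RH-FREE. **Blaschke uniqueness, power-series form** ([Rudin, RCA, Thm 15.23] for real zeros, proved
here without Jensen's formula): if `a ∈ ℓ²(ℕ)` and the power series `F(y) = Σ a_k y^k` vanishes at distinct
nonzero real points `x_n` of the unit disc with `Σ (1 − |x_n|) = ∞`, then `a = 0`.  Proof: divide out the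
leading power of `y`, then the first `N` zeros by the finite Blaschke product; the mean value property
for `h_N²` on `|y| = r` and Parseval give `∏_{n<N} x_n^{−2} ≤ Σ|a_k|²/|a_m|²` for every `N`,
contradicting `∏ x_n² → 0`.
[cite: ConnesConsani2021QuasiInner, §2 Remark after Thm 2.3 (arXiv Rem. 1, chunk p0006:L72–L85), citing Rudin, Real and Complex Analysis, Thm 15.23] -/
theorem eq_zero_of_tsum_mul_pow_eq_zero {a : ℕ → ℂ} (ha : Summable fun k => ‖a k‖ ^ 2)
    {x : ℕ → ℝ} (hx1 : ∀ n, |x n| < 1) (hx0 : ∀ n, x n ≠ 0) (hinj : Function.Injective x)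
    (hdiv : ¬ Summable fun n => 1 - |x n|) (hzero : ∀ n, ∑' k, a k * (x n : ℂ) ^ k = 0) :
    a = 0 := by
  by_contra hne
  have hex : ∃ k, a k ≠ 0 := by
    by_contra h
    push Not at h
    exact hne (funext h)
  classical
  obtain ⟨m, hm, hmin⟩ : ∃ m, a m ≠ 0 ∧ ∀ k < m, a k = 0 :=
    ⟨Nat.find hex, Nat.find_spec hex, fun k hk => by simpa using Nat.find_min hex hk⟩
  -- the shifted coefficients `b_k = a_{k+m}` and their power series `G`
  set b : ℕ → ℂ := fun k => a (k + m) with hb_def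
  have hb : Summable fun k => ‖b k‖ ^ 2 := (summable_nat_add_iff m).2 ha
  set S : ℝ := ∑' k, ‖b k‖ ^ 2 with hS_def
  have hMa : ∀ k, ‖a k‖ ≤ max 1 (∑' j, ‖a j‖ ^ 2) := norm_le_max_one_tsum_sq ha
  have hMb : ∀ k, ‖b k‖ ≤ max 1 (∑' j, ‖a j‖ ^ 2) := fun k => hMa (k + m)
  set G : ℂ → ℂ := fun y => ∑' k, b k * y ^ k with hG_def
  have hGdiff : DifferentiableOn ℂ G (ball 0 1) := differentiableOn_tsum_mul_pow hMb
  have hG0 : G 0 = b 0 := by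
    simp only [hG_def]
    rw [tsum_eq_single 0 (fun k hk => by simp [hk])]
    simp
  have hGx : ∀ n, G (x n) = 0 := by
    intro n
    have hxn : ‖(x n : ℂ)‖ < 1 := by
      rw [Complex.norm_real, Real.norm_eq_abs]; exact hx1 n
    have hsa : Summable fun k => a k * (x n : ℂ) ^ k := summable_mul_pow_of_norm_lt_one hMa hxn
    have h1 := hsa.sum_add_tsum_nat_add m
    rw [hzero n, Finset.sum_eq_zero (fun k hk => by
      rw [Finset.mem_range] at hk; rw [hmin k hk, zero_mul]), zero_add] at h1
    have h2 : (∑' k, a (k + m) * (x n : ℂ) ^ (k + m)) = (x n : ℂ) ^ m * G (x n) := by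
      simp only [hG_def, ← tsum_mul_left]
      refine tsum_congr fun k => ?_
      rw [pow_add]; ring
    rw [h2] at h1
    exact (mul_eq_zero.1 h1).resolve_left (pow_ne_zero _ (by exact_mod_cast hx0 n))
  have hGavg : ∀ r, 0 ≤ r → r < 1 → Real.circleAverage (fun y => ‖G y‖ ^ 2) 0 r ≤ S :=
    fun r hr0 hr1 => circleAverage_norm_sq_tsum_mul_pow_le hb hr0 hr1
  have hS0 : 0 ≤ S := tsum_nonneg fun k => by positivity
  -- MAIN CLAIM: `‖b 0‖² ≤ S · ∏_{n<N} x_n²` for every `N`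
  have hclaim : ∀ N : ℕ, ‖b 0‖ ^ 2 ≤ S * ∏ n ∈ Finset.range N, x n ^ 2 := by
    intro N
    obtain ⟨q, hq, hqG⟩ := exists_differentiableOn_mul_prod_sub_eq hGdiff hx1 hinj hGx N
    have hP0 : (∏ n ∈ Finset.range N, x n ^ 2) ≠ 0 :=
      Finset.prod_ne_zero_iff.2 fun n _ => pow_ne_zero _ (hx0 n)
    have hPpos : 0 < ∏ n ∈ Finset.range N, x n ^ 2 :=
      lt_of_le_of_ne (Finset.prod_nonneg fun n _ => sq_nonneg _) hP0.symm
    -- `q 0 = b 0 / ∏ (−x_n)`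
    have hq0 : ‖q 0‖ ^ 2 * ∏ n ∈ Finset.range N, x n ^ 2 = ‖b 0‖ ^ 2 := by
      have h := hqG 0 (mem_ball_self one_pos)
      rw [hG0] at h
      rw [← h, norm_mul, mul_pow, norm_prod, ← Finset.prod_pow]
      congr 1
      refine Finset.prod_congr rfl fun n _ => ?_
      rw [zero_sub, norm_neg, Complex.norm_real, Real.norm_eq_abs, sq_abs]
    -- the Blaschke quotient `h_N(y) = (q(y) ∏ (1 − x_n y))²`
    set C : ℝ → ℝ := fun r => ∏ n ∈ Finset.range N, (1 + (1 - x n ^ 2) * (1 - r ^ 2) / (r - |x n|) ^ 2)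
      with hC_def
    set h : ℂ → ℂ := fun y => (q y * ∏ n ∈ Finset.range N, (1 - (x n : ℂ) * y)) ^ 2 with hh_def
    have hhdiff : DifferentiableOn ℂ h (ball 0 1) := by
      have hprod : ∀ M : ℕ, DifferentiableOn ℂ
          (fun y : ℂ => ∏ n ∈ Finset.range M, (1 - (x n : ℂ) * y)) (ball 0 1) := by
        intro M
        induction M with
        | zero => simp only [Finset.prod_range_zero]; exact differentiableOn_const _
        | succ M ih =>
          simp only [Finset.prod_range_succ]
          exact ih.mul ((differentiableOn_const _).sub
            ((differentiableOn_const _).mul differentiableOn_id))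
      exact (hq.mul (hprod N)).pow 2
    have hh0 : h 0 = q 0 ^ 2 := by simp [hh_def]
    -- for `r` close to `1⁻`: `‖b 0‖²/∏x_n² = ‖h 0‖ ≤ C(r) · S`
    have hev : ∀ᶠ r in 𝓝[<] (1:ℝ), ‖b 0‖ ^ 2 / ∏ n ∈ Finset.range N, x n ^ 2 ≤ C r * S := by
      have hev1 : ∀ᶠ r in 𝓝[<] (1:ℝ), ∀ n ∈ Finset.range N, |x n| < r :=
        (Finset.eventually_all _).2 fun n _ =>
          (eventually_gt_nhds (hx1 n)).filter_mono nhdsWithin_le_nhds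
      have hev2 : ∀ᶠ r in 𝓝[<] (1:ℝ), r < 1 := eventually_nhdsWithin_of_forall fun r hr => hr
      have hev3 : ∀ᶠ r in 𝓝[<] (1:ℝ), 0 < r :=
        (eventually_gt_nhds one_pos).filter_mono nhdsWithin_le_nhds
      filter_upwards [hev1, hev2, hev3] with r hxr hr1 hr0
      have habs : |r| = r := abs_of_pos hr0
      -- mean value property for `h` on `|y| = r`
      have hmv : Real.circleAverage h 0 r = h 0 := by
        have hdc : DiffContOnCl ℂ h (ball (0:ℂ) |r|) := by
          rw [habs]
          exact hhdiff.diffContOnCl_ball (closedBall_subset_ball hr1)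
        exact hdc.circleAverage
      -- pointwise bound on the circle
      have hsphere : ∀ y ∈ sphere (0:ℂ) |r|, ‖h y‖ ≤ C r * ‖G y‖ ^ 2 := by
        intro y hy
        rw [habs, mem_sphere_zero_iff_norm] at hy
        have hyball : y ∈ ball (0:ℂ) 1 := by rw [mem_ball_zero_iff, hy]; exact hr1
        have hyx : ∀ n ∈ Finset.range N, y - (x n : ℂ) ≠ 0 := by
          intro n hn heq
          rw [sub_eq_zero] at heq
          have := hxr n hn
          rw [heq, Complex.norm_real, Real.norm_eq_abs] at hy
          linarith
        have hPy : ∏ n ∈ Finset.range N, (y - (x n : ℂ)) ≠ 0 := Finset.prod_ne_zero_iff.2 hyx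
        have hqy : q y = G y / ∏ n ∈ Finset.range N, (y - (x n : ℂ)) := by
          rw [eq_div_iff hPy]; exact hqG y hyball
        rw [hh_def]
        simp only
        rw [norm_pow, norm_mul, hqy, norm_div, norm_prod, norm_prod, div_mul_eq_mul_div, div_pow,
          mul_pow, ← Finset.prod_pow, ← Finset.prod_pow, mul_div_assoc, ← Finset.prod_div_distrib,
          mul_comm]
        refine mul_le_mul_of_nonneg_right ?_ (by positivity)
        refine Finset.prod_le_prod (fun n _ => by positivity) fun n hn => ?_
        rw [div_le_iff₀ (by have := hyx n hn; positivity)]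
        exact norm_one_sub_mul_sq_le (hxr n hn) hr1 hy
      have hGcont : ContinuousOn (fun y => C r * ‖G y‖ ^ 2) (sphere (0:ℂ) |r|) := by
        refine continuousOn_const.mul ((hGdiff.continuousOn.mono ?_).norm.pow 2)
        rw [habs]; exact sphere_subset_closedBall.trans (closedBall_subset_ball hr1)
      have hhcont : ContinuousOn (fun y => ‖h y‖) (sphere (0:ℂ) |r|) := by
        refine (hhdiff.continuousOn.mono ?_).norm
        rw [habs]; exact sphere_subset_closedBall.trans (closedBall_subset_ball hr1)
      calc ‖b 0‖ ^ 2 / ∏ n ∈ Finset.range N, x n ^ 2 = ‖h 0‖ := by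
            rw [hh0, norm_pow, div_eq_iff hP0, hq0]
        _ = ‖Real.circleAverage h 0 r‖ := by rw [hmv]
        _ ≤ Real.circleAverage (fun y => ‖h y‖) 0 r := norm_circleAverage_le_circleAverage_norm h 0 r
        _ ≤ Real.circleAverage (fun y => C r * ‖G y‖ ^ 2) 0 r :=
            Real.circleAverage_mono hhcont.circleIntegrable' hGcont.circleIntegrable' hsphere
        _ = C r * Real.circleAverage (fun y => ‖G y‖ ^ 2) 0 r := by
            rw [← smul_eq_mul, ← Real.circleAverage_fun_smul]; rfl
        _ ≤ C r * S := by
            refine mul_le_mul_of_nonneg_left (hGavg r hr0.le hr1) ?_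
            exact Finset.prod_nonneg fun n hn => by
              have h1 : x n ^ 2 < 1 := by rw [← sq_abs]; nlinarith [abs_nonneg (x n), hx1 n]
              have h2 : r ^ 2 < 1 := by nlinarith
              have : (0:ℝ) ≤ (1 - x n ^ 2) * (1 - r ^ 2) / (r - |x n|) ^ 2 :=
                div_nonneg (mul_nonneg (by linarith) (by linarith)) (sq_nonneg _)
              linarith
    -- let `r → 1⁻`
    have hlim : ‖b 0‖ ^ 2 / ∏ n ∈ Finset.range N, x n ^ 2 ≤ 1 * S :=
      le_of_tendsto_of_tendsto tendsto_const_nhds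
        ((tendsto_prod_blaschkeMajorant hx1 N).mul_const S) hev
    rw [one_mul, div_le_iff₀ hPpos] at hlim
    exact hlim
  -- conclusion: `∏ x_n² → 0` forces `b 0 = 0`
  have hlim0 : Tendsto (fun N => S * ∏ n ∈ Finset.range N, x n ^ 2) atTop (𝓝 (S * 0)) :=
    (tendsto_prod_sq_of_not_summable hx1 hdiv).const_mul S
  rw [mul_zero] at hlim0
  have hb0 : ‖b 0‖ ^ 2 ≤ 0 := ge_of_tendsto' hlim0 hclaim
  have : b 0 = 0 := by
    have : ‖b 0‖ = 0 := by nlinarith [norm_nonneg (b 0)]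
    exact norm_eq_zero.1 this
  exact hm (by simpa [hb_def] using this)



/-! ### A. Moment uniqueness: `Σ_n c_n x_n^k = 0` for all `k ≥ 0` forces `c = 0` -/

/-- RH-FREE. A real sequence of nonzero terms converging to `1` is bounded away from `0`. [folklore] -/
private theorem exists_pos_le_abs_of_tendsto_one {x : ℕ → ℝ} (hx0 : ∀ n, x n ≠ 0)
    (hlim : Tendsto x atTop (𝓝 1)) : ∃ c₀ : ℝ, 0 < c₀ ∧ ∀ n, c₀ ≤ |x n| := by
  classical
  have hev : ∀ᶠ n in atTop, (1/2 : ℝ) ≤ |x n| := by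
    have h : Tendsto (fun n => |x n|) atTop (𝓝 |(1:ℝ)|) := hlim.abs
    rw [abs_one] at h
    exact h.eventually (eventually_ge_nhds (by norm_num))
  obtain ⟨N₀, hN₀⟩ := eventually_atTop.1 hev
  set s : Finset ℝ := insert (1/2 : ℝ) ((Finset.range N₀).image fun n => |x n|) with hs
  have hne : s.Nonempty := Finset.insert_nonempty _ _
  refine ⟨s.min' hne, ?_, fun n => ?_⟩
  · rw [Finset.lt_min'_iff]
    intro y hy
    rw [Finset.mem_insert, Finset.mem_image] at hy
    rcases hy with rfl | ⟨n, -, rfl⟩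
    · norm_num
    · exact abs_pos.2 (hx0 n)
  · by_cases hn : n < N₀
    · exact Finset.min'_le _ _ (Finset.mem_insert_of_mem (Finset.mem_image.2 ⟨n, by simpa using hn, rfl⟩))
    · exact (Finset.min'_le _ _ (Finset.mem_insert_self _ _)).trans (hN₀ n (not_lt.1 hn))

/-- RH-FREE. For `x` real nonzero: `1 − x z = x (x⁻¹ − z)`, so `‖1 − xz‖ = |x|·‖x⁻¹ − z‖`. [folklore] -/
private theorem norm_one_sub_mul_eq {x : ℝ} (hx : x ≠ 0) (z : ℂ) :
    ‖1 - (x : ℂ) * z‖ = |x| * ‖((x : ℂ))⁻¹ - z‖ := by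
  have hx' : (x : ℂ) ≠ 0 := by exact_mod_cast hx
  have : 1 - (x : ℂ) * z = (x : ℂ) * (((x : ℂ))⁻¹ - z) := by
    rw [mul_sub, mul_inv_cancel₀ hx']
  rw [this, norm_mul, Complex.norm_real, Real.norm_eq_abs]

/-- RH-FREE. Uniform lower bound for `‖1 − x_n z‖` on a ball that stays `δ`-away from the `x_n⁻¹`. [folklore] -/
private theorem norm_one_sub_mul_ge_of_forall_dist {x : ℕ → ℝ} {c₀ : ℝ} (hc₀le : ∀ n, c₀ ≤ |x n|)
    (hx0 : ∀ n, x n ≠ 0) {w₀ : ℂ} {ε : ℝ} (hε : 0 ≤ ε) {P : ℕ → Prop}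
    (hfar : ∀ n, P n → ε ≤ ‖((x n : ℂ))⁻¹ - w₀‖) {z : ℂ} (hz : z ∈ ball w₀ (ε / 2)) {n : ℕ} (hn : P n) :
    c₀ * (ε / 2) ≤ ‖1 - (x n : ℂ) * z‖ := by
  rw [norm_one_sub_mul_eq (hx0 n)]
  have h1 : ε / 2 ≤ ‖((x n : ℂ))⁻¹ - z‖ := by
    have hz' : ‖z - w₀‖ < ε / 2 := mem_ball_iff_norm.1 hz
    have := hfar n hn
    linarith [norm_sub_le_norm_sub_add_norm_sub (((x n : ℂ))⁻¹) z w₀]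
  exact mul_le_mul (hc₀le n) h1 (by linarith) (abs_nonneg _)

/-- RH-FREE. **Moment uniqueness.** Let `c ∈ ℓ¹(ℕ)` and let `x_n` be distinct nonzero reals in `(−1,1)`
with `x_n → 1`. If `Σ_n c_n x_n^k = 0` for every `k ≥ 0`, then `c = 0`.  Proof: the function
`Φ(w) = Σ_n c_n/(1 − x_n w)` is holomorphic off the countable closed set `{x_n⁻¹} ∪ {1}`, whose complement
is connected; on the unit disc `Φ(w) = Σ_k (Σ_n c_n x_n^k) w^k = 0`, so `Φ ≡ 0`; isolating the simple pole
at `x_m⁻¹` gives `c_m = 0`.  This is the tree's form of the printed step «a vector in the kernel must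
vanish on all the poles `x(n)` of `κ`» of the Remark after Thm 2.3, re-derived from the rank-one expansion
of Theorem 2.3 instead of the meromorphic continuation of `κ f`.
[cite: ConnesConsani2021QuasiInner, §2 Remark after Thm 2.3 (arXiv Rem. 1, chunk p0006:L72–L85), proof step] -/
theorem eq_zero_of_forall_tsum_mul_pow_eq_zero {c : ℕ → ℂ} (hc : Summable fun n => ‖c n‖)
    {x : ℕ → ℝ} (hx1 : ∀ n, |x n| < 1) (hx0 : ∀ n, x n ≠ 0) (hinj : Function.Injective x)
    (hlim : Tendsto x atTop (𝓝 1)) (h : ∀ k : ℕ, ∑' n, c n * (x n : ℂ) ^ k = 0) : c = 0 := by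
  classical
  obtain ⟨c₀, hc₀, hc₀le⟩ := exists_pos_le_abs_of_tendsto_one hx0 hlim
  -- the poles `w_n = x_n⁻¹ → 1`
  set w : ℕ → ℂ := fun n => ((x n : ℂ))⁻¹ with hw_def
  have hwlim : Tendsto w atTop (𝓝 1) := by
    have h1 : Tendsto (fun n => (x n : ℂ)) atTop (𝓝 ((1:ℝ) : ℂ)) :=
      (Complex.continuous_ofReal.tendsto 1).comp hlim
    simpa [hw_def] using h1.inv₀ (by simp)
  have hnormw : ∀ n, 1 < ‖w n‖ := by
    intro n
    rw [hw_def]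
    simp only [norm_inv, Complex.norm_real, Real.norm_eq_abs]
    exact one_lt_inv_iff₀.2 ⟨abs_pos.2 (hx0 n), hx1 n⟩
  -- the singular set `S` and its complement `U`
  set S : Set ℂ := insert 1 (range w) with hS_def
  have hSclosed : IsClosed S := hwlim.isCompact_insert_range.isClosed
  have hScount : S.Countable := (countable_range w).insert 1
  set U : Set ℂ := Sᶜ with hU_def
  have hUopen : IsOpen U := hSclosed.isOpen_compl
  have hUconn : IsPreconnected U :=
    (hScount.isConnected_compl_of_one_lt_rank (by simp)).isPreconnected
  have hballU : ball (0:ℂ) 1 ⊆ U := by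
    intro z hz
    rw [mem_ball_zero_iff] at hz
    rw [hU_def, mem_compl_iff, hS_def, mem_insert_iff, mem_range, not_or, not_exists]
    refine ⟨fun h1 => ?_, fun n hn => ?_⟩
    · rw [h1, norm_one] at hz; exact lt_irrefl _ hz
    · have := hnormw n; rw [hn] at this; linarith
  -- the terms and their sum `Φ`
  set f : ℕ → ℂ → ℂ := fun n z => c n / (1 - (x n : ℂ) * z) with hf_def
  set Φ : ℂ → ℂ := fun z => ∑' n, f n z with hΦ_def
  -- local uniform control near any point of `U`, or near a pole with that pole removed
  have hloc : ∀ (w₀ : ℂ) (ε : ℝ), 0 < ε → ∀ P : ℕ → Prop, (∀ n, P n → ε ≤ ‖w n - w₀‖) →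
      ∀ z ∈ ball w₀ (ε / 2), ∀ n, P n →
        (1 - (x n : ℂ) * z ≠ 0) ∧ ‖f n z‖ ≤ ‖c n‖ / (c₀ * (ε / 2)) := by
    intro w₀ ε hε P hfar z hz n hn
    have hb := norm_one_sub_mul_ge_of_forall_dist hc₀le hx0 hε.le hfar hz hn
    have hpos : 0 < c₀ * (ε / 2) := by positivity
    have hne : 1 - (x n : ℂ) * z ≠ 0 := by
      intro h0; rw [h0, norm_zero] at hb; linarith
    refine ⟨hne, ?_⟩
    rw [hf_def]
    simp only [norm_div]
    exact div_le_div_of_nonneg_left (norm_nonneg _) hpos hb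
  -- `Φ` is holomorphic on `U`
  have hΦdiff : DifferentiableOn ℂ Φ U := by
    intro w₀ hw₀
    obtain ⟨ε, hε, hball⟩ := Metric.isOpen_iff.1 hUopen w₀ hw₀
    have hfar : ∀ n, True → ε ≤ ‖w n - w₀‖ := by
      intro n _
      by_contra hlt
      push Not at hlt
      have : w n ∈ U := hball (mem_ball_iff_norm.2 hlt)
      exact this (mem_insert_of_mem _ (mem_range_self n))
    have hdiff : DifferentiableOn ℂ Φ (ball w₀ (ε / 2)) := by
      refine differentiableOn_tsum_of_summable_norm (u := fun n => ‖c n‖ / (c₀ * (ε / 2)))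
        (hc.div_const _) (fun n => ?_) isOpen_ball fun n z hz => ((hloc w₀ ε hε _ hfar z hz n trivial).2)
      refine DifferentiableOn.div (differentiableOn_const _) (by fun_prop) fun z hz => ?_
      exact (hloc w₀ ε hε _ hfar z hz n trivial).1
    exact (hdiff.differentiableAt (isOpen_ball.mem_nhds (mem_ball_self (by positivity)))).differentiableWithinAt
  -- `Φ = 0` on the unit disc
  have hΦball : ∀ z ∈ ball (0:ℂ) 1, Φ z = 0 := by
    intro z hz
    rw [mem_ball_zero_iff] at hz
    have hq : ∀ n, ‖(x n : ℂ) * z‖ < 1 := by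
      intro n
      rw [norm_mul, Complex.norm_real, Real.norm_eq_abs]
      calc |x n| * ‖z‖ ≤ 1 * ‖z‖ := mul_le_mul_of_nonneg_right (hx1 n).le (norm_nonneg _)
        _ < 1 := by rw [one_mul]; exact hz
    -- the double series `Σ_{n,k} c_n (x_n z)^k` is absolutely summable
    have hF : Summable (Function.uncurry fun n k => c n * ((x n : ℂ) * z) ^ k) := by
      have h2 : Summable fun p : ℕ × ℕ => c p.1 * z ^ p.2 :=
        summable_mul_of_summable_norm hc (by
          simpa [norm_pow] using summable_geometric_of_lt_one (norm_nonneg _) hz)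
      refine Summable.of_norm_bounded (g := fun p : ℕ × ℕ => ‖c p.1 * z ^ p.2‖) h2.norm ?_
      rintro ⟨n, k⟩
      simp only [Function.uncurry_apply_pair, norm_mul, norm_pow, Complex.norm_real, Real.norm_eq_abs]
      refine mul_le_mul_of_nonneg_left ?_ (norm_nonneg _)
      exact pow_le_pow_left₀ (by positivity) (by
        calc |x n| * ‖z‖ ≤ 1 * ‖z‖ := mul_le_mul_of_nonneg_right (hx1 n).le (norm_nonneg _)
          _ = ‖z‖ := one_mul _) k
    calc Φ z = ∑' n, c n * ∑' k, ((x n : ℂ) * z) ^ k := by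
          simp only [hΦ_def, hf_def]
          refine tsum_congr fun n => ?_
          rw [tsum_geometric_of_norm_lt_one (hq n), div_eq_mul_inv]
      _ = ∑' n, ∑' k, c n * ((x n : ℂ) * z) ^ k := by
          refine tsum_congr fun n => ?_; rw [tsum_mul_left]
      _ = ∑' k, ∑' n, c n * ((x n : ℂ) * z) ^ k := (hF.tsum_comm).symm
      _ = ∑' k, z ^ k * ∑' n, c n * (x n : ℂ) ^ k := by
          refine tsum_congr fun k => ?_
          rw [← tsum_mul_left]
          refine tsum_congr fun n => ?_
          rw [mul_pow]; ring
      _ = 0 := by simp [h]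
  -- identity theorem: `Φ = 0` on `U`
  have hΦU : EqOn Φ 0 U := by
    have hanal : AnalyticOnNhd ℂ Φ U := hΦdiff.analyticOnNhd hUopen
    refine hanal.eqOn_zero_of_preconnected_of_eventuallyEq_zero hUconn (hballU (mem_ball_self one_pos)) ?_
    exact Filter.eventuallyEq_iff_exists_mem.2 ⟨ball 0 1, isOpen_ball.mem_nhds (mem_ball_self one_pos),
      fun z hz => hΦball z hz⟩
  -- isolate the pole at `w m = x_m⁻¹`
  funext m
  -- the singular set with the `m`-th pole replaced by the limit point `1`
  set w' : ℕ → ℂ := fun n => if n = m then 1 else w n with hw'_def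
  have hw'lim : Tendsto w' atTop (𝓝 1) := by
    refine hwlim.congr' ?_
    filter_upwards [eventually_gt_atTop m] with n hn
    rw [hw'_def]; simp [hn.ne']
  set S' : Set ℂ := insert 1 (range w') with hS'_def
  have hS'closed : IsClosed S' := hw'lim.isCompact_insert_range.isClosed
  have hwm : w m ∉ S' := by
    rw [hS'_def, mem_insert_iff, mem_range, not_or, not_exists]
    refine ⟨fun h1 => ?_, fun n hn => ?_⟩
    · have := hnormw m; rw [h1, norm_one] at this; exact lt_irrefl _ this
    · rw [hw'_def] at hn
      by_cases hnm : n = m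
      · simp only [hnm, if_true] at hn
        have := hnormw m; rw [← hn, norm_one] at this; exact lt_irrefl _ this
      · simp only [hnm, if_false, hw_def] at hn
        have := inv_injective hn
        exact hnm (hinj (by exact_mod_cast this))
  obtain ⟨ρ, hρ, hρball⟩ := Metric.isOpen_iff.1 hS'closed.isOpen_compl (w m) hwm
  have hfar : ∀ n, n ≠ m → ρ ≤ ‖w n - w m‖ := by
    intro n hn
    by_contra hlt
    push Not at hlt
    have h1 : w n ∈ S'ᶜ := hρball (mem_ball_iff_norm.2 hlt)
    exact h1 (mem_insert_of_mem _ ⟨n, by rw [hw'_def]; simp [hn]⟩)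
  have hfar1 : ρ ≤ ‖1 - w m‖ := by
    by_contra hlt
    push Not at hlt
    exact hρball (mem_ball_iff_norm.2 hlt) (mem_insert _ _)
  -- the regular part `Φ_m` near `w m`
  set Φm : ℂ → ℂ := fun z => ∑' n, if n = m then 0 else f n z with hΦm_def
  have hΦm_cont : ContinuousOn Φm (ball (w m) (ρ / 2)) := by
    refine continuousOn_tsum (u := fun n => ‖c n‖ / (c₀ * (ρ / 2))) (fun n => ?_) (hc.div_const _)
      fun n z hz => ?_
    · by_cases hnm : n = m
      · simp only [hnm, if_true]; exact continuousOn_const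
      · simp only [hnm, if_false]
        refine ContinuousOn.div continuousOn_const (by fun_prop) fun z hz => ?_
        exact (hloc (w m) ρ hρ (fun n => n ≠ m) hfar z hz n hnm).1
    · by_cases hnm : n = m
      · simp only [hnm, if_true, norm_zero]; positivity
      · simp only [hnm, if_false]
        exact (hloc (w m) ρ hρ (fun n => n ≠ m) hfar z hz n hnm).2
  -- on the punctured ball: `c m = −(1 − x_m z) Φ_m(z)`
  have hpunct : ∀ z ∈ ball (w m) (ρ / 2), z ≠ w m → c m = -(1 - (x m : ℂ) * z) * Φm z := by
    intro z hz hzm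
    have hzU : z ∈ U := by
      rw [hU_def, mem_compl_iff, hS_def, mem_insert_iff, mem_range, not_or, not_exists]
      have hz' : ‖z - w m‖ < ρ / 2 := mem_ball_iff_norm.1 hz
      refine ⟨fun h1 => ?_, fun n hn => ?_⟩
      · rw [h1] at hz'; linarith [norm_sub_rev (1:ℂ) (w m)]
      · by_cases hnm : n = m
        · rw [hnm] at hn; exact hzm hn.symm
        · have := hfar n hnm; rw [hn] at this; linarith
    have hΦz : Φ z = 0 := hΦU hzU
    -- split off the `m`-th term
    have hg : Summable fun n => if n = m then 0 else f n z :=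
      Summable.of_norm_bounded (g := fun n => ‖c n‖ / (c₀ * (ρ / 2))) (hc.div_const _) fun n => by
        by_cases hnm : n = m
        · simp only [hnm, if_true, norm_zero]; positivity
        · simp only [hnm, if_false]
          exact (hloc (w m) ρ hρ (fun n => n ≠ m) hfar z hz n hnm).2
    have he : HasSum (fun n => if n = m then f m z else 0) (f m z) := hasSum_ite_eq m (f m z)
    have hsplit : Φ z = f m z + Φm z := by
      have hfg : (fun n => f n z) = fun n => (if n = m then f m z else 0) + (if n = m then 0 else f n z) := by
        funext n
        by_cases hnm : n = m
        · subst hnm; simp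
        · simp [hnm]
      rw [hΦ_def]
      simp only
      rw [hfg, he.summable.tsum_add hg, he.tsum_eq]
    have hne : 1 - (x m : ℂ) * z ≠ 0 := by
      rw [sub_ne_zero]
      intro h1
      apply hzm
      rw [hw_def]
      exact eq_inv_of_mul_eq_one_right h1.symm
    rw [hΦz, hf_def] at hsplit
    simp only at hsplit
    field_simp at hsplit
    linear_combination -hsplit
  -- let `z → w m`
  have hψ : ContinuousOn (fun z => -(1 - (x m : ℂ) * z) * Φm z) (ball (w m) (ρ / 2)) :=
    (ContinuousOn.neg (by fun_prop)).mul hΦm_cont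
  have hψ0 : -(1 - (x m : ℂ) * w m) * Φm (w m) = 0 := by
    have hxm : (x m : ℂ) ≠ 0 := by exact_mod_cast hx0 m
    rw [hw_def]
    simp only
    rw [mul_inv_cancel₀ hxm, sub_self, neg_zero, zero_mul]
  have htend : Tendsto (fun z => -(1 - (x m : ℂ) * z) * Φm z) (𝓝[≠] (w m)) (𝓝 0) := by
    have h1 := (hψ (w m) (mem_ball_self (by positivity))).continuousAt
      (isOpen_ball.mem_nhds (mem_ball_self (by positivity)))
    rw [ContinuousAt, hψ0] at h1
    exact h1.mono_left nhdsWithin_le_nhds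
  have hconst : Tendsto (fun _ : ℂ => c m) (𝓝[≠] (w m)) (𝓝 0) := by
    refine htend.congr' ?_
    have hmem : {w m}ᶜ ∩ ball (w m) (ρ / 2) ∈ 𝓝[≠] (w m) :=
      inter_mem_nhdsWithin _ (isOpen_ball.mem_nhds (mem_ball_self (x := w m) (half_pos hρ)))
    filter_upwards [hmem] with z hz
    exact (hpunct z hz.2 hz.1).symm
  simpa using (tendsto_nhds_unique hconst tendsto_const_nhds).symm


/-! ### C. The vectors `ξ_x`, `η_x` and the expansion of `(1 − 𝒫)κ𝒫` applied to a vector -/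

/-- RH-FREE. Nonnegative modes lie in `H²`. [cite: ConnesConsani2021QuasiInner, Introduction, Definition (arXiv chunk p0003:L5)] -/
theorem fourierLp_natCast_mem_hardySpace (T : ℝ) [hT : Fact (0 < T)] (m : ℕ) :
    fourierLp (T := T) 2 (m : ℤ) ∈ hardySpace T := by
  rw [mem_hardySpace_iff]
  intro n
  rw [orthonormal_iff_ite.1 (orthonormal_fourier (T := T))]
  have : (-(n + 1 : ℤ)) ≠ (m : ℤ) := by omega
  rw [if_neg this]

/-- RH-FREE. `⟨e_i | f⟩` is the `i`-th Fourier coefficient, i.e. the `i`-th coordinate in the Fourier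
Hilbert basis. [folklore] -/
private theorem inner_fourierLp_eq_repr (f : Lp ℂ 2 (haarAddCircle (T := (1:ℝ)))) (i : ℤ) :
    ⟪fourierLp (T := (1:ℝ)) 2 i, f⟫_ℂ = (fourierBasis (T := (1:ℝ))).repr f i := by
  rw [← coe_fourierBasis]
  exact (fourierBasis.repr_apply_apply f i).symm

/-- RH-FREE. The Fourier coordinates of an `L²(S¹)` function are square-summable (Parseval). [folklore] -/
private theorem summable_norm_sq_inner_fourierLp (f : Lp ℂ 2 (haarAddCircle (T := (1:ℝ)))) :
    Summable fun i : ℤ => ‖⟪fourierLp (T := (1:ℝ)) 2 i, f⟫_ℂ‖ ^ 2 := by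
  have h := (hasSum_sq_fourierCoeff (T := (1:ℝ)) f).summable
  refine h.congr fun i => ?_
  rw [inner_fourierLp_eq_repr, fourierBasis_repr]

/-- RH-FREE. An `L²(S¹)` function all of whose Fourier coordinates vanish is zero. [folklore] -/
private theorem eq_zero_of_forall_inner_fourierLp_eq_zero {f : Lp ℂ 2 (haarAddCircle (T := (1:ℝ)))}
    (h : ∀ i : ℤ, ⟪fourierLp (T := (1:ℝ)) 2 i, f⟫_ℂ = 0) : f = 0 := by
  have hrepr : (fourierBasis (T := (1:ℝ))).repr f = 0 := by
    refine lp.ext (funext fun i => ?_)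
    rw [← inner_fourierLp_eq_repr, h i]
    rfl
  exact (LinearIsometryEquiv.map_eq_zero_iff _).1 hrepr

/-- RH-FREE. **The evaluation functional of `H²`**: `⟨η_y | f⟩ = Σ_k y^k ⟨e_k | f⟩` (`|y| < 1`), i.e. pairing
with the Szegő kernel `η_y` evaluates the holomorphic extension `Σ f̂(k) y^k` at `y`.
[cite: ConnesConsani2021QuasiInner, Lemma 2.2 (arXiv chunk p0006:L14–L21) and §2 Remark after Thm 2.3 (p0006:L72–L85)] -/
theorem inner_etaVec_eq_tsum (y : ℂ) (hy : ‖y‖ < 1) (f : Lp ℂ 2 (haarAddCircle (T := (1:ℝ)))) :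
    HasSum (fun k : ℕ => y ^ k * ⟪fourierLp (T := (1:ℝ)) 2 (k : ℤ), f⟫_ℂ) ⟪etaVec 1 y, f⟫_ℂ := by
  have h1 := (innerSL ℂ f).hasSum (hasSum_etaVec (T := (1:ℝ)) y hy)
  simp only [innerSL_apply_apply, inner_smul_right] at h1
  have h3 : HasSum (fun k : ℕ => conj (conj y ^ k * ⟪f, fourierLp (T := (1:ℝ)) 2 (k : ℤ)⟫_ℂ))
      (conj ⟪f, etaVec 1 y⟫_ℂ) :=
    (h1.map (starRingEnd ℂ : ℂ →+* ℂ) Complex.continuous_conj)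
  simp only [map_mul, map_pow, Complex.conj_conj, inner_conj_symm] at h3
  exact h3

/-- RH-FREE. Dually, `⟨ξ_y | g⟩ = Σ_k ȳ^k ⟨e_{−k−1} | g⟩` (`|y| < 1`).
[cite: ConnesConsani2021QuasiInner, Lemma 2.2 (arXiv chunk p0006:L14–L21)] -/
theorem inner_xiVec_eq_tsum (y : ℂ) (hy : ‖y‖ < 1) (g : Lp ℂ 2 (haarAddCircle (T := (1:ℝ)))) :
    HasSum (fun k : ℕ => conj y ^ k * ⟪fourierLp (T := (1:ℝ)) 2 (-(k + 1 : ℤ)), g⟫_ℂ)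
      ⟪xiVec 1 y, g⟫_ℂ := by
  have h1 := (innerSL ℂ g).hasSum (hasSum_xiVec (T := (1:ℝ)) y hy)
  simp only [innerSL_apply_apply, inner_smul_right] at h1
  have h3 : HasSum (fun k : ℕ => conj (y ^ k * ⟪g, fourierLp (T := (1:ℝ)) 2 (-(k + 1 : ℤ))⟫_ℂ))
      (conj ⟪g, xiVec 1 y⟫_ℂ) :=
    (h1.map (starRingEnd ℂ : ℂ →+* ℂ) Complex.continuous_conj)
  simp only [map_mul, map_pow, inner_conj_symm] at h3
  exact h3

/-- RH-FREE. **Blaschke uniqueness in `H²(𝕌)`** (boundary form, real zeros): an `f ∈ H²` whose holomorphic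
extension vanishes (`⟨η_{x_n} | f⟩ = 0`) along distinct nonzero real points `x_n` of the disc with
`Σ(1 − |x_n|) = ∞` is zero.
[cite: ConnesConsani2021QuasiInner, §2 Remark after Thm 2.3 (arXiv Rem. 1, chunk p0006:L72–L85), citing Rudin, Real and Complex Analysis, Thm 15.23] -/
theorem eq_zero_of_mem_hardySpace_of_inner_etaVec_eq_zero {f : Lp ℂ 2 (haarAddCircle (T := (1:ℝ)))}
    (hf : f ∈ hardySpace 1) {x : ℕ → ℝ} (hx1 : ∀ n, |x n| < 1) (hx0 : ∀ n, x n ≠ 0)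
    (hinj : Function.Injective x) (hdiv : ¬ Summable fun n => 1 - |x n|)
    (hzero : ∀ n, ⟪etaVec 1 (x n : ℂ), f⟫_ℂ = 0) : f = 0 := by
  set a : ℕ → ℂ := fun k => ⟪fourierLp (T := (1:ℝ)) 2 (k : ℤ), f⟫_ℂ with ha_def
  have ha : Summable fun k => ‖a k‖ ^ 2 :=
    (summable_norm_sq_inner_fourierLp f).comp_injective Nat.cast_injective
  have hz : ∀ n, ∑' k, a k * (x n : ℂ) ^ k = 0 := by
    intro n
    have hxn : ‖(x n : ℂ)‖ < 1 := by rw [Complex.norm_real, Real.norm_eq_abs]; exact hx1 n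
    rw [← hzero n, ← (inner_etaVec_eq_tsum _ hxn f).tsum_eq]
    exact tsum_congr fun k => mul_comm _ _
  have ha0 := eq_zero_of_tsum_mul_pow_eq_zero ha hx1 hx0 hinj hdiv hz
  refine eq_zero_of_forall_inner_fourierLp_eq_zero fun i => ?_
  rcases lt_or_ge i 0 with hi | hi
  · obtain ⟨m, rfl⟩ : ∃ m : ℕ, i = -(m + 1 : ℤ) := ⟨(-i - 1).toNat, by omega⟩
    exact (mem_hardySpace_iff 1 f).1 hf m
  · obtain ⟨k, rfl⟩ : ∃ k : ℕ, i = (k : ℤ) := ⟨i.toNat, by omega⟩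
    exact congrFun ha0 k

/-- RH-FREE. **Blaschke uniqueness in `(H²)^⊥`** (the mirror statement, for `ξ_x` in place of `η_x`): a
`g ⊥ H²` with `⟨ξ_{x_n} | g⟩ = 0` along a real non-Blaschke sequence is zero.
[cite: ConnesConsani2021QuasiInner, §2 Remark after Thm 2.3 (arXiv Rem. 1, chunk p0006:L72–L85)] -/
theorem eq_zero_of_mem_hardySpace_orthogonal_of_inner_xiVec_eq_zero
    {g : Lp ℂ 2 (haarAddCircle (T := (1:ℝ)))}
    (hg : g ∈ (hardySpace 1)ᗮ) {x : ℕ → ℝ} (hx1 : ∀ n, |x n| < 1) (hx0 : ∀ n, x n ≠ 0)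
    (hinj : Function.Injective x) (hdiv : ¬ Summable fun n => 1 - |x n|)
    (hzero : ∀ n, ⟪xiVec 1 (x n : ℂ), g⟫_ℂ = 0) : g = 0 := by
  set a : ℕ → ℂ := fun k => ⟪fourierLp (T := (1:ℝ)) 2 (-(k + 1 : ℤ)), g⟫_ℂ with ha_def
  have ha : Summable fun k => ‖a k‖ ^ 2 :=
    (summable_norm_sq_inner_fourierLp g).comp_injective
      (show Function.Injective (fun k : ℕ => (-(k + 1 : ℤ))) from fun a b h => by simpa using h)
  have hz : ∀ n, ∑' k, a k * (x n : ℂ) ^ k = 0 := by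
    intro n
    have hxn : ‖(x n : ℂ)‖ < 1 := by rw [Complex.norm_real, Real.norm_eq_abs]; exact hx1 n
    rw [← hzero n, ← (inner_xiVec_eq_tsum _ hxn g).tsum_eq]
    refine tsum_congr fun k => ?_
    rw [Complex.conj_ofReal, mul_comm]
  have ha0 := eq_zero_of_tsum_mul_pow_eq_zero ha hx1 hx0 hinj hdiv hz
  refine eq_zero_of_forall_inner_fourierLp_eq_zero fun i => ?_
  rcases lt_or_ge i 0 with hi | hi
  · obtain ⟨m, rfl⟩ : ∃ m : ℕ, i = -(m + 1 : ℤ) := ⟨(-i - 1).toNat, by omega⟩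
    exact congrFun ha0 m
  · obtain ⟨k, rfl⟩ : ∃ k : ℕ, i = (k : ℤ) := ⟨i.toNat, by omega⟩
    exact Submodule.inner_right_of_mem_orthogonal (fourierLp_natCast_mem_hardySpace 1 k) hg

/-! ### D. The poles `x(n)` of `κ`: the non-Blaschke sequence of Theorem 2.3 -/

/-- RH-FREE. `x(n) ≠ 0`. [cite: ConnesConsani2021QuasiInner, §2 (arXiv chunk p0005:L122)] -/
theorem xArch_ne_zero (n : ℕ) : xArch n ≠ 0 := by
  intro h
  rw [xArch, sub_eq_zero, eq_div_iff (by positivity)] at h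
  rcases Nat.eq_zero_or_pos n with hn | hn
  · subst hn; norm_num at h
  · have : (1:ℝ) ≤ n := by exact_mod_cast hn
    linarith

/-- RH-FREE. `x(n) → 1` in `ℝ` (the `ℂ`-valued form is `tendsto_xArch` of `QuasiInnerArchDiscResidues`). [cite: ConnesConsani2021QuasiInner, §2 (arXiv chunk p0005:L122)] -/
theorem tendsto_xArch_real : Tendsto xArch atTop (𝓝 1) := by
  have h : Tendsto (fun n : ℕ => (4:ℝ) / (4 * n + 3)) atTop (𝓝 0) := by
    refine tendsto_const_nhds.div_atTop ?_
    refine tendsto_atTop_add_const_right _ _ ?_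
    exact (tendsto_natCast_atTop_atTop (R := ℝ)).const_mul_atTop (by norm_num)
  have := tendsto_const_nhds (x := (1:ℝ)) |>.sub h
  rw [sub_zero] at this
  exact this.congr fun n => rfl

/-- RH-FREE. **The non-Blaschke condition** «`Σ(1 − |x(n)|) = ∞`» (`1 − x(n) ∼ 1/n`).
[cite: ConnesConsani2021QuasiInner, §2 Remark after Thm 2.3 (arXiv Rem. 1, chunk p0006:L72–L85)] -/
theorem not_summable_one_sub_abs_xArch : ¬ Summable fun n => 1 - |xArch n| := by
  intro hs
  have hle : ∀ n : ℕ, (1:ℝ) / 2 * (1 / ((n:ℝ) + 1)) ≤ 1 - |xArch n| := by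
    intro n
    rcases Nat.eq_zero_or_pos n with hn | hn
    · subst hn
      rw [show xArch 0 = -(1/3 : ℝ) by norm_num [xArch], abs_neg, abs_of_pos (by norm_num)]
      norm_num
    · have h1 : (1:ℝ) ≤ n := by exact_mod_cast hn
      have hpos : 0 < 4 * (n:ℝ) + 3 := by positivity
      have hx : 0 ≤ xArch n := by
        rw [xArch, sub_nonneg, div_le_one hpos]; linarith
      rw [abs_of_nonneg hx, xArch, sub_sub_cancel,
        show (1:ℝ) / 2 * (1 / ((n:ℝ) + 1)) = 1 / (2 * ((n:ℝ) + 1)) by rw [div_mul_div_comm, one_mul],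
        div_le_div_iff₀ (by positivity) hpos]
      linarith
  have h2 : Summable fun n : ℕ => (1:ℝ) / 2 * (1 / ((n:ℝ) + 1)) :=
    hs.of_nonneg_of_le (fun n => by positivity) hle
  have h3 : Summable fun n : ℕ => 1 / ((n:ℝ) + 1) := by
    have := h2.mul_left 2
    refine this.congr fun n => ?_
    ring
  have h4 : Summable fun n : ℕ => 1 / ((n : ℕ) : ℝ) := by
    rw [← summable_nat_add_iff 1]
    refine h3.congr fun n => ?_
    push_cast; ring
  exact Real.not_summable_one_div_natCast h4

/-! ### E. Theorem 2.3 applied to a vector; the Remark -/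

/-- RH-FREE. The scalar weights `c_n ‖η_{x_n}‖⁻¹ ‖ξ_{x_n}‖⁻¹` of the expansion of `(1 − 𝒫)κ𝒫 v`. [folklore] -/
private theorem r23_norms_pos (n : ℕ) :
    0 < ‖xiVec 1 (xArch n : ℂ)‖ ∧ 0 < ‖etaVec 1 (xArch n : ℂ)‖ ∧
      ‖xiVec 1 (xArch n : ℂ)‖ = ‖etaVec 1 (xArch n : ℂ)‖ ∧ 1 ≤ ‖xiVec 1 (xArch n : ℂ)‖ := by
  have hx : ‖(xArch n : ℂ)‖ < 1 := by
    rw [Complex.norm_real, Real.norm_eq_abs]; exact xArch_lt_one n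
  have h1 := norm_xiVec_sq (T := (1:ℝ)) _ hx
  have h2 := norm_etaVec_sq (T := (1:ℝ)) _ hx
  have hge : (1:ℝ) ≤ (1 - ‖(xArch n : ℂ)‖ ^ 2)⁻¹ := by
    refine one_le_inv_iff₀.2 ⟨by nlinarith [norm_nonneg (xArch n : ℂ)], by nlinarith [norm_nonneg (xArch n : ℂ)]⟩
  have hxi1 : 1 ≤ ‖xiVec 1 (xArch n : ℂ)‖ := by
    by_contra hlt
    push Not at hlt
    have : ‖xiVec 1 (xArch n : ℂ)‖ ^ 2 < 1 := by
      nlinarith [norm_nonneg (xiVec 1 (xArch n : ℂ))]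
    linarith
  have heq : ‖xiVec 1 (xArch n : ℂ)‖ = ‖etaVec 1 (xArch n : ℂ)‖ :=
    (sq_eq_sq₀ (norm_nonneg _) (norm_nonneg _)).1 (h1.trans h2.symm)
  exact ⟨by linarith, by linarith [heq], heq, hxi1⟩

/-- RH-FREE. The coefficients of Theorem 2.3 never vanish. [cite: ConnesConsani2021QuasiInner, Thm 2.3 «thmkappa» (arXiv chunk p0006:L54)] -/
theorem thm23Coeff_ne_zero (n : ℕ) : thm23Coeff n ≠ 0 := by
  unfold thm23Coeff
  have h1 : 0 < Real.Gamma ((n : ℝ) + 1) := Real.Gamma_pos_of_pos (by positivity)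
  have h2 : 0 < Real.Gamma ((n : ℝ) + 1 / 2) := Real.Gamma_pos_of_pos (by positivity)
  have h3 : 0 < Real.sqrt π := Real.sqrt_pos.2 Real.pi_pos
  refine div_ne_zero ?_ (by positivity)
  exact mul_ne_zero (mul_ne_zero (pow_ne_zero _ (by norm_num)) two_ne_zero) (by positivity)

/-- RH-FREE. **Theorem 2.3 applied to a pair of vectors**: `⟨z | (1 − 𝒫)κ𝒫 v⟩ = Σ_n e_n ⟨η_{x_n} | v⟩⟨z | ξ_{x_n}⟩`
with the real weights `e_n = c_n‖η_{x_n}‖⁻¹‖ξ_{x_n}‖⁻¹`.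
[cite: ConnesConsani2021QuasiInner, Thm 2.3 «thmkappa» (arXiv chunk p0006:L51–L57)] -/
theorem hasSum_inner_hardyOffDiag_kappaArch (z v : Lp ℂ 2 (haarAddCircle (T := (1:ℝ)))) :
    HasSum (fun n : ℕ => ((thm23Coeff n * (‖etaVec 1 (xArch n : ℂ)‖⁻¹ * ‖xiVec 1 (xArch n : ℂ)‖⁻¹) : ℝ) : ℂ)
        * ⟪etaVec 1 (xArch n : ℂ), v⟫_ℂ * ⟪z, xiVec 1 (xArch n : ℂ)⟫_ℂ)
      ⟪z, hardyOffDiag 1 (toLpOrZero ∞ haarAddCircle (circleRestrict 1 kappaArch)) v⟫_ℂ := by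
  have h := ((innerSL ℂ z).comp (ContinuousLinearMap.apply ℂ _ v)).hasSum thm_2_3_holds
  simp only [ContinuousLinearMap.comp_apply, ContinuousLinearMap.apply_apply,
    smul_apply, InnerProductSpace.rankOne_apply, innerSL_apply_apply,
    inner_smul_left, inner_smul_right, map_inv₀, Complex.conj_ofReal] at h
  exact h.congr_fun fun n => by push_cast; ring

/-- RH-FREE. The weights are dominated: `|e_n|·‖η_{x_n}‖·‖w‖ ≤ |c_n|·‖w‖` and `Σ|c_n| < ∞`. [folklore] -/
private theorem r23_weight_bound (n : ℕ) :
    |thm23Coeff n * (‖etaVec 1 (xArch n : ℂ)‖⁻¹ * ‖xiVec 1 (xArch n : ℂ)‖⁻¹)| * ‖etaVec 1 (xArch n : ℂ)‖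
      ≤ |thm23Coeff n| := by
  obtain ⟨hxi, heta, heq, h1⟩ := r23_norms_pos n
  rw [abs_mul, abs_of_pos (by positivity : 0 < ‖etaVec 1 (xArch n : ℂ)‖⁻¹ * ‖xiVec 1 (xArch n : ℂ)‖⁻¹)]
  calc |thm23Coeff n| * (‖etaVec 1 (xArch n : ℂ)‖⁻¹ * ‖xiVec 1 (xArch n : ℂ)‖⁻¹) * ‖etaVec 1 (xArch n : ℂ)‖
      = |thm23Coeff n| * ‖xiVec 1 (xArch n : ℂ)‖⁻¹ * (‖etaVec 1 (xArch n : ℂ)‖⁻¹ * ‖etaVec 1 (xArch n : ℂ)‖) := by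
        ring
    _ = |thm23Coeff n| * ‖xiVec 1 (xArch n : ℂ)‖⁻¹ := by rw [inv_mul_cancel₀ heta.ne', mul_one]
    _ ≤ |thm23Coeff n| * 1 :=
        mul_le_mul_of_nonneg_left (inv_le_one_of_one_le₀ h1) (abs_nonneg _)
    _ = |thm23Coeff n| := mul_one _

/-- RH-FREE. `Σ |c_n| < ∞` for the coefficients of Theorem 2.3. [cite: ConnesConsani2021QuasiInner, Thm 2.3 «thmkappa» (arXiv chunk p0006:L49–L57)] -/
private theorem r23_summable_abs_thm23Coeff : Summable fun n => |thm23Coeff n| := by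
  have hmaj : Summable fun n : ℕ => 4 * Real.sqrt π * (π ^ 2) ^ n / (Nat.factorial n : ℝ) := by
    have := (Real.summable_pow_div_factorial (π ^ 2)).mul_left (4 * Real.sqrt π)
    refine this.congr fun n => ?_
    ring
  exact hmaj.of_nonneg_of_le (fun n => abs_nonneg _) abs_thm23Coeff_le

/-- RH-FREE. **Remark following Theorem 2.3 PROVED** (arXiv Remark 1): «The operator `(1 − 𝒫)ρ_∞𝒫` is
injective [on `H²`] and has dense range [in `(H²)^⊥`]» — «this follows from Theorem 2.3: a vector `f` in
the kernel must vanish on all the poles `x(n)` of `κ`, and since `Σ(1 − |x(n)|) = ∞` this implies `f = 0`;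
similarly for the adjoint».  Tree road: Theorem 2.3 (`thm_2_3_holds`) gives
`⟨z | (1 − 𝒫)κ𝒫 v⟩ = Σ_n e_n⟨η_{x_n}|v⟩⟨z|ξ_{x_n}⟩`; testing against the modes `e_{−k−1}` (resp. applying
to the modes `e_k`) and the moment uniqueness `eq_zero_of_forall_tsum_mul_pow_eq_zero` give
`⟨η_{x_n}|f⟩ = 0` (resp. `⟨ξ_{x_n}|g⟩ = 0`) for all `n`, and the Blaschke uniqueness theorems
`eq_zero_of_mem_hardySpace_of_inner_etaVec_eq_zero` / `…_orthogonal_of_inner_xiVec_eq_zero` conclude.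
Discharges the named fact `remark_2_3`.
[cite: ConnesConsani2021QuasiInner, §2 Remark after Thm 2.3 (arXiv Rem. 1; chunk p0006:L72–L85)] -/
theorem remark_2_3_holds : remark_2_3 := by
  unfold remark_2_3
  intro A
  -- common data
  set e : ℕ → ℝ := fun n =>
    thm23Coeff n * (‖etaVec 1 (xArch n : ℂ)‖⁻¹ * ‖xiVec 1 (xArch n : ℂ)‖⁻¹) with he_def
  have hxlt : ∀ n, ‖(xArch n : ℂ)‖ < 1 := fun n => by
    rw [Complex.norm_real, Real.norm_eq_abs]; exact xArch_lt_one n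
  have he0 : ∀ n, (e n : ℂ) ≠ 0 := by
    intro n
    obtain ⟨hxi, heta, -, -⟩ := r23_norms_pos n
    have : e n ≠ 0 := mul_ne_zero (thm23Coeff_ne_zero n) (by positivity)
    exact_mod_cast this
  refine ⟨fun f hf hAf => ?_, fun g hg => ?_⟩
  · -- injectivity on `H²`
    have hmom : ∀ k : ℕ, ∑' n, ((e n : ℂ) * ⟪etaVec 1 (xArch n : ℂ), f⟫_ℂ) * (xArch n : ℂ) ^ k = 0 := by
      intro k
      have h := hasSum_inner_hardyOffDiag_kappaArch (fourierLp (T := (1:ℝ)) 2 (-(k + 1 : ℤ))) f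
      have hA : hardyOffDiag 1 (toLpOrZero ∞ haarAddCircle (circleRestrict 1 kappaArch)) f = 0 := hAf
      rw [hA, inner_zero_right] at h
      rw [← h.tsum_eq]
      refine tsum_congr fun n => ?_
      rw [inner_fourierLp_negSucc_xiVec 1 _ (hxlt n) k]
    have hsum : Summable fun n => ‖(e n : ℂ) * ⟪etaVec 1 (xArch n : ℂ), f⟫_ℂ‖ := by
      refine (r23_summable_abs_thm23Coeff.mul_right ‖f‖).of_nonneg_of_le (fun n => norm_nonneg _)
        fun n => ?_
      rw [norm_mul, Complex.norm_real, Real.norm_eq_abs]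
      calc |e n| * ‖⟪etaVec 1 (xArch n : ℂ), f⟫_ℂ‖
          ≤ |e n| * (‖etaVec 1 (xArch n : ℂ)‖ * ‖f‖) :=
            mul_le_mul_of_nonneg_left (norm_inner_le_norm _ _) (abs_nonneg _)
        _ = |e n| * ‖etaVec 1 (xArch n : ℂ)‖ * ‖f‖ := by ring
        _ ≤ |thm23Coeff n| * ‖f‖ := mul_le_mul_of_nonneg_right (r23_weight_bound n) (norm_nonneg _)
    have hc := eq_zero_of_forall_tsum_mul_pow_eq_zero hsum (fun n => xArch_lt_one n) xArch_ne_zero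
      xArch_injective tendsto_xArch_real hmom
    refine eq_zero_of_mem_hardySpace_of_inner_etaVec_eq_zero hf (fun n => xArch_lt_one n) xArch_ne_zero
      xArch_injective not_summable_one_sub_abs_xArch fun n => ?_
    have := congrFun hc n
    simp only [Pi.zero_apply, mul_eq_zero] at this
    exact this.resolve_left (he0 n)
  · -- dense range in `(H²)^⊥`
    set M := (Submodule.map A.toLinearMap (hardySpace 1)).topologicalClosure with hM_def
    haveI : CompleteSpace M := (Submodule.isClosed_topologicalClosure _).completeSpace_coe
    -- `A(H²) ⊆ (H²)^⊥`, hence `M ⊆ (H²)^⊥`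
    have hMK : M ≤ (hardySpace 1)ᗮ := by
      refine Submodule.topologicalClosure_minimal _ ?_ (Submodule.isClosed_orthogonal _)
      rintro _ ⟨f, -, rfl⟩
      exact Submodule.sub_starProjection_mem_orthogonal (K := hardySpace 1)
        ((mulOp haarAddCircle (toLpOrZero ∞ haarAddCircle (circleRestrict 1 kappaArch)))
          (hardyProjection 1 f))
    set g₂ := g - M.starProjection g with hg₂_def
    have hg₂M : g₂ ∈ Mᗮ := Submodule.sub_starProjection_mem_orthogonal g
    have hg₂K : g₂ ∈ (hardySpace 1)ᗮ := Submodule.sub_mem _ hg (hMK (Submodule.starProjection_apply_mem M g))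
    suffices hzero : g₂ = 0 by
      rw [hg₂_def, sub_eq_zero] at hzero
      rw [hzero]; exact Submodule.starProjection_apply_mem M g
    have hmom : ∀ k : ℕ, ∑' n, ((e n : ℂ) * ⟪g₂, xiVec 1 (xArch n : ℂ)⟫_ℂ) * (xArch n : ℂ) ^ k = 0 := by
      intro k
      have h := hasSum_inner_hardyOffDiag_kappaArch g₂ (fourierLp (T := (1:ℝ)) 2 (k : ℤ))
      have hAM : A (fourierLp (T := (1:ℝ)) 2 (k : ℤ)) ∈ M :=
        Submodule.le_topologicalClosure _ ⟨_, fourierLp_natCast_mem_hardySpace 1 k, rfl⟩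
      have h0 : ⟪g₂, A (fourierLp (T := (1:ℝ)) 2 (k : ℤ))⟫_ℂ = 0 :=
        inner_eq_zero_symm.1 (Submodule.inner_right_of_mem_orthogonal hAM hg₂M)
      have hA : ⟪g₂, hardyOffDiag 1 (toLpOrZero ∞ haarAddCircle (circleRestrict 1 kappaArch))
          (fourierLp (T := (1:ℝ)) 2 (k : ℤ))⟫_ℂ = 0 := h0
      rw [hA] at h
      rw [← h.tsum_eq]
      refine tsum_congr fun n => ?_
      rw [← inner_conj_symm (etaVec 1 _), inner_fourierLp_natCast_etaVec (T := (1:ℝ)) _ (hxlt n) k, map_pow,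
        Complex.conj_conj]
      simp only [he_def]
      ring
    have hsum : Summable fun n => ‖(e n : ℂ) * ⟪g₂, xiVec 1 (xArch n : ℂ)⟫_ℂ‖ := by
      refine (r23_summable_abs_thm23Coeff.mul_right ‖g₂‖).of_nonneg_of_le (fun n => norm_nonneg _)
        fun n => ?_
      obtain ⟨-, -, heq, -⟩ := r23_norms_pos n
      rw [norm_mul, Complex.norm_real, Real.norm_eq_abs]
      calc |e n| * ‖⟪g₂, xiVec 1 (xArch n : ℂ)⟫_ℂ‖
          ≤ |e n| * (‖g₂‖ * ‖xiVec 1 (xArch n : ℂ)‖) :=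
            mul_le_mul_of_nonneg_left (norm_inner_le_norm _ _) (abs_nonneg _)
        _ = |e n| * ‖etaVec 1 (xArch n : ℂ)‖ * ‖g₂‖ := by rw [heq]; ring
        _ ≤ |thm23Coeff n| * ‖g₂‖ := mul_le_mul_of_nonneg_right (r23_weight_bound n) (norm_nonneg _)
    have hc := eq_zero_of_forall_tsum_mul_pow_eq_zero hsum (fun n => xArch_lt_one n) xArch_ne_zero
      xArch_injective tendsto_xArch_real hmom
    refine eq_zero_of_mem_hardySpace_orthogonal_of_inner_xiVec_eq_zero hg₂K (fun n => xArch_lt_one n)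
      xArch_ne_zero xArch_injective not_summable_one_sub_abs_xArch fun n => ?_
    have := congrFun hc n
    simp only [Pi.zero_apply, mul_eq_zero] at this
    exact inner_eq_zero_symm.1 (this.resolve_left (he0 n))

end QuasiInner

end Literature.NumberTheory.ConnesConsani2021
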